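import Summits.ResolutionOfSingularities.ResolutionOfSingularities.Theorems.WeightedInvariantWeightedThesisHypersurfaceStrategy
import Summits.ResolutionOfSingularities.ResolutionOfSingularities.Theorems.WeightedInvariantWeightedThesisHypersurfaceTower
import HarnessLib

/-!
# Crux `WeightedThesis` (stmt-ResolutionOfSingularities-0569): a hypersurface centre STRATEGY suffices

Topic: `Summits/ResolutionOfSingularities/ResolutionOfSingularities/Theorems`. Route
`ResolutionOfSingularities/WeightedInvariant`, crux `Theses.WeightedInvariant.WeightedThesis` (resolution
of every reduced separated scheme of finite type over every PERFECT field of characteristic `p`, every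
prime `p`), line `datum-glued-split`, lead c8, RESHAPE 8 — the tower for the STRATEGY interface
`HypersurfaceCentreStrategy p` (`Theorems/…HypersurfaceStrategy.lean`: a centre rule on singular integral
hypersurface pairs with `(iii)` regular weighted centre, `(ii')` generic point off the support, `(i)`
functoriality for smooth surjections, `(T)` well-foundedness of the tower-step relation).

RESHAPE 7 (lead c7) ran Włodarczyk's cobordant tower for a hypersurface resolution DATUM by well-founded
induction on `max inv ∈ Γ` (`HypersurfaceTower.maxinv_induction`). Here the same tower is run by
well-founded induction on the tower-step relation itself, which is all the induction ever used:

* `HypersurfaceStrategyTower.wellFounded_step_of_hypersurfaceDatum`,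
  `hyp_nonempty_strategy_of_hypersurfaceDatum` (registered stub of the line) — every hypersurface
  resolution datum is a strategy: termination by the drop of `max inv`
  (`InvDrop.inv_drop_of_hypersurfaceDatum`), the other three properties being the datum's `(iii)`, `(i)`
  and `(ii)`+`(iii)` under the guard supplied by `hyp_exists_not_isBot_inv_of_not_isRegular`; hence
  `WeightedConstruction` (stmt-0571) ⇒ hypersurface construction (RESHAPE 7) ⇒ hypersurface strategy;
* `CentreHomogeneous.centre_isHomogeneous_of_strategy` — on a graded ambient chart the centre of a
  strategy is homogeneous (functoriality along the torus coaction, the proof of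
  `centre_isHomogeneous_of_hypersurfaceDatum` verbatim with the guard "not regular");
* `HypersurfaceStrategyTower.hasResolution_quotient_of_gradedAtlas` — the tower: well-founded induction
  on `HypersurfacePair.Step S.centre`; base = `V(X)` regular ⇒ quotient singularities ⇒ Bergh–Rydh over
  `k`; step = the datum-free tower lemmas (`…TowerGenericAmbient`, `…TowerGenericQuotient`) for the
  centre `S.centre f (ker i)`, the successor pair being `Step`-below by `Step.intro`;
The field-wise corollaries and the RESHAPE 8 composition
(`weightedThesis_of_hypersurfaceStrategy_of_forall_berghRydh_charP`) are in the sibling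
`Theorems/WeightedInvariantWeightedThesisHypersurfaceStrategyAssembly.lean`.
-/

noncomputable section

open scoped LaurentPolynomial
open LaurentPolynomial CategoryTheory CategoryTheory.Limits AlgebraicGeometry TopologicalSpace
open Literature.AlgebraicGeometry.Resolution
open Summit.ResolutionOfSingularities.ResolutionOfSingularities.Theses.WeightedInvariant
open Summit.ResolutionOfSingularities.ResolutionOfSingularities.Theorems

set_option linter.dupNamespace false -- mandated namespace of this single-conjunct summit

/-! ## Every hypersurface resolution datum is a strategy -/

namespace Summit.ResolutionOfSingularities.ResolutionOfSingularities.Theorems.HypersurfaceStrategyTower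

/-- **The cobordant tower of a hypersurface datum stops**: the tower-step relation of its centre is
well-founded — one step strictly lowers `max_Y inv ∈ D.Γ` (axiom `(i)` for `inv` along the chart
immersions and the drop `(iv)` on the charts, `InvDrop.inv_drop_of_hypersurfaceDatum`; the maximum is
attained, `HypersurfaceTower.exists_isMax_inv`), and `D.Γ` is a well-order.
[cite: AbramovichTemkinWlodarczyk2024, Thm. 1.1.1 (proof: "by induction on `maxinv`")] -/
theorem wellFounded_step_of_hypersurfaceDatum {p : ℕ} (D : HypersurfaceResolutionDatum p) {k : Type}
    [Field k] [CharP k p] [PerfectField k] :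
    WellFounded (HypersurfacePair.Step (k := k) fun ⦃Y : Scheme.{0}⦄ (f : Y ⟶ Spec (.of k)) X =>
      D.centre f X) := by
  -- the measure `max_Y inv`
  let μ : HypersurfacePair k → D.Γ := fun P => D.inv P.f P.X (Classical.choose
    (HypersurfaceTower.exists_isMax_inv D P.f P.X P.isLocallyPrincipal P.isIntegral))
  have hμ : ∀ (P : HypersurfacePair k) (y : P.Y), D.inv P.f P.X y ≤ μ P := fun P y =>
    Classical.choose_spec
      (HypersurfaceTower.exists_isMax_inv D P.f P.X P.isLocallyPrincipal P.isIntegral) y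
  refine Subrelation.wf (r := InvImage (· < ·) μ) ?_ (InvImage.wf μ wellFounded_lt)
  intro P' P h
  obtain ⟨hsing, R', hR', hs, hsep, hqc, hlp, hint, rfl⟩ := h
  haveI := hs; haveI := hsep; haveI := hqc
  obtain ⟨y₀, hy₀⟩ :=
    HypersurfaceTower.exists_isMax_inv D P.f P.X P.isLocallyPrincipal P.isIntegral
  have hguard := hyp_exists_not_isBot_inv_of_not_isRegular D P.f P.X P.isLocallyPrincipal
    P.isIntegral hsing
  change μ _ < μ P
  refine lt_of_lt_of_le ?_ (hμ P y₀)
  exact DatumToEmbedded.InvDrop.inv_drop_of_hypersurfaceDatum D P.f P.X P.isLocallyPrincipal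
    P.isIntegral hguard y₀ hy₀ R' hR' hlp hint _

/-- **Every hypersurface resolution datum is a hypersurface centre strategy** (forget `Γ` and `inv`):
the centre is kept; `(iii)` and `(i)` for the centre are the datum's, under the guard "`inv` somewhere
non-minimal" supplied from non-regularity by `(ii)` (`hyp_exists_not_isBot_inv_of_not_isRegular`); the
generic point is off the centre by `(ii)` + `(iii)` (`HypersurfaceTower.genericPoint_not_mem_support_centre`);
termination is `wellFounded_step_of_hypersurfaceDatum`. [folklore] -/
theorem nonempty_strategy_of_hypersurfaceDatum {p : ℕ} (D : HypersurfaceResolutionDatum p) :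
    Nonempty (HypersurfaceCentreStrategy p) :=
  ⟨{ centre := D.centre
     isRegularWeightedCentre_centre := fun _ _ _ _ _ f _ _ _ X hX hXi hsing =>
       D.isRegularWeightedCentre_centre f X hX hXi
         (hyp_exists_not_isBot_inv_of_not_isRegular D f X hX hXi hsing)
     genericPoint_not_mem_support_centre := fun _ _ _ _ _ _ f _ _ _ i _ _ hX hsing =>
       HypersurfaceTower.genericPoint_not_mem_support_centre D f i hX
         (HypersurfaceTower.isIntegral_ker_subscheme i)
         (hyp_exists_not_isBot_inv_of_not_isRegular D f i.ker hX
           (HypersurfaceTower.isIntegral_ker_subscheme i)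
           fun h => hsing ((isRegular_iff_isRegular_image i).mpr h))
     centre_comap := fun _ _ _ _ _ _ f _ _ _ f₁ _ _ _ g _ _ hg X hX hXi hsing n =>
       D.centre_comap f f₁ g hg X hX hXi
         (hyp_exists_not_isBot_inv_of_not_isRegular D f X hX hXi hsing) n
     wellFounded_step := fun _ _ _ _ => wellFounded_step_of_hypersurfaceDatum D }⟩

/-- **Registered form `hyp_nonempty_strategy_of_hypersurfaceDatum`** (registered stub of line
`datum-glued-split`, RESHAPE 8): a hypersurface resolution datum in characteristic `p` yields a
hypersurface centre strategy in characteristic `p` — so RESHAPE 7's first stub implies RESHAPE 8's.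
[folklore] -/
theorem hyp_nonempty_strategy_of_hypersurfaceDatum : ∀ {p : ℕ}, Summit.ResolutionOfSingularities.ResolutionOfSingularities.Theorems.HypersurfaceResolutionDatum p → Nonempty (Summit.ResolutionOfSingularities.ResolutionOfSingularities.Theorems.HypersurfaceCentreStrategy p) :=
  fun D => nonempty_strategy_of_hypersurfaceDatum D

/-- **`WeightedConstruction` (stmt-0571) implies the hypersurface strategy**, prime by prime: a weighted
resolution datum is a hypersurface datum (`HypersurfaceResolutionDatum.ofDatum`), which is a strategy.
[folklore] -/
theorem nonempty_strategy_of_datum {p : ℕ} (h : Nonempty (WeightedResolutionDatum p)) :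
    Nonempty (HypersurfaceCentreStrategy p) := by
  obtain ⟨D⟩ := HypersurfaceResolutionDatum.nonempty_of_nonempty_datum h
  exact nonempty_strategy_of_hypersurfaceDatum D

end Summit.ResolutionOfSingularities.ResolutionOfSingularities.Theorems.HypersurfaceStrategyTower

/-! ## The centre of a strategy is homogeneous on graded charts -/

namespace Summit.ResolutionOfSingularities.ResolutionOfSingularities.Theorems.DatumToEmbedded.CentreHomogeneous

open AddMonoidAlgebra

/-- **On a graded ambient chart the centre of a hypersurface centre strategy is homogeneous** (the
statement of `centre_isHomogeneous_of_hypersurfaceDatum` for `S : HypersurfaceCentreStrategy p`, on a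
singular hypersurface pair `(Y, I)`): for a `𝔾ₘʲ`-stable affine chart `W ⊆ Y` — a `ℤʲ`-grading `𝒜` of
`Γ(Y, W)` with the constants in degree `0` for which `I(W)` is homogeneous — every piece
`(S.centre f I).piece n` has homogeneous ideal of sections over `W`: property `(i)` of the strategy
applied to the two smooth surjective `k`-morphisms `act ⊔ 𝟙_Y, pr ⊔ 𝟙_Y : (Spec Γ(Y, W)[ℤʲ]) ⊔ Y ⟶ Y`,
which have the same composite to `Spec k` and pull `I` back to the same ideal sheaf (Włodarczyk 2022,
Thm. 1.1.4 (6): functoriality for group actions). [cite: Wlodarczyk2022, Thm. 1.1.4 (6)] -/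
theorem centre_isHomogeneous_of_strategy
    {p : ℕ} (S : HypersurfaceCentreStrategy p) {k : Type} [Field k] [CharP k p] [PerfectField k]
    {Y : Scheme.{0}} (f : Y ⟶ Spec (.of k)) [Smooth f] [IsSeparated f] [QuasiCompact f]
    (I : Y.IdealSheafData) (hI : IsLocallyPrincipal I) (hIi : IsIntegral I.subscheme)
    (hsing : ¬ Scheme.IsRegular I.subscheme)
    {j : ℕ} (W : Y.affineOpens) (𝒜 : (Fin j → ℤ) → AddSubgroup Γ(Y, W)) [GradedRing 𝒜]
    (h0 : ∀ c : Γ(Spec (.of k), ⊤), f.appLE ⊤ W le_top c ∈ 𝒜 0)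
    (hIhom : (I.ideal W).IsHomogeneous 𝒜) (n : ℕ) :
    (((S.centre f I).piece n).ideal W).IsHomogeneous 𝒜 := by
  obtain ⟨ρ, hρ⟩ := exists_coaction 𝒜
  -- the torus chart `T = 𝔾ₘʲ × W` with its action and projection maps to `Y`
  let L : Type := (Γ(Y, W) : Type)[Fin j → ℤ]
  let T : Scheme.{0} := Spec (.of L)
  let φa : Γ(Y, W) ⟶ CommRingCat.of L := CommRingCat.ofHom ρ
  let φp : Γ(Y, W) ⟶ CommRingCat.of L := CommRingCat.ofHom singleZeroRingHom
  let act : T ⟶ Y := Spec.map φa ≫ W.2.fromSpec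
  let pr : T ⟶ Y := Spec.map φp ≫ W.2.fromSpec
  haveI : Smooth (Spec.map φa) :=
    (HasRingHomProperty.Spec_iff (P := @Smooth)).mpr (smooth_coaction 𝒜 ρ hρ)
  haveI : Smooth (Spec.map φp) :=
    (HasRingHomProperty.Spec_iff (P := @Smooth)).mpr (smooth_singleZeroRingHom _ j)
  haveI : Smooth act := inferInstance
  haveI : Smooth pr := inferInstance
  -- the two maps agree on `Spec k` (constants have degree `0`) …
  have hcompT : act ≫ f = pr ≫ f := by
    have key : f.appLE ⊤ W le_top ≫ φa = f.appLE ⊤ W le_top ≫ φp := by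
      apply CommRingCat.hom_ext
      refine RingHom.ext fun c => ?_
      simp only [φa, φp, CommRingCat.hom_comp, CommRingCat.hom_ofHom, RingHom.comp_apply]
      exact hρ 0 _ (h0 c)
    simp only [act, pr, Category.assoc]
    rw [← IsAffineOpen.SpecMap_appLE_fromSpec f (isAffineOpen_top _) W.2 le_top,
      ← Spec.map_comp_assoc, ← Spec.map_comp_assoc, key]
  -- … and pull `I` back to the same ideal sheaf (`I(W)` is homogeneous)
  have hcomapT : I.comap act = I.comap pr := by
    refine Scheme.IdealSheafData.ext_of_isAffine ?_
    simp only [act, pr]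
    rw [comap_SpecMap_fromSpec_ideal_top, comap_SpecMap_fromSpec_ideal_top]
    simp only [φa, φp, CommRingCat.hom_ofHom]
    rw [map_coaction_eq_of_isHomogeneous 𝒜 ρ hρ hIhom]
  -- glue each with the identity of `Y`: smooth surjective `k`-morphisms `T ⊔ Y ⟶ Y`
  obtain ⟨g, hgl, hgr, _, _, _, _⟩ : ∃ g : T ⨿ Y ⟶ Y, coprod.inl ≫ g = act ∧
      coprod.inr ≫ g = 𝟙 Y ∧ Smooth g ∧ Surjective g ∧ QuasiCompact (g ≫ f) ∧
      IsSeparated (g ≫ f) :=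
    ⟨coprod.desc act (𝟙 Y), coprod.inl_desc _ _, coprod.inr_desc _ _, smooth_coprodDesc act,
      surjective_coprodDesc act, quasiCompact_coprodDesc_comp act f,
      isSeparated_coprodDesc_comp act f⟩
  obtain ⟨g', hgl', hgr', _, _, _, _⟩ : ∃ g : T ⨿ Y ⟶ Y, coprod.inl ≫ g = pr ∧
      coprod.inr ≫ g = 𝟙 Y ∧ Smooth g ∧ Surjective g ∧ QuasiCompact (g ≫ f) ∧
      IsSeparated (g ≫ f) :=
    ⟨coprod.desc pr (𝟙 Y), coprod.inl_desc _ _, coprod.inr_desc _ _, smooth_coprodDesc pr,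
      surjective_coprodDesc pr, quasiCompact_coprodDesc_comp pr f,
      isSeparated_coprodDesc_comp pr f⟩
  have hcomp : g ≫ f = g' ≫ f := by
    apply coprod.hom_ext
    · rw [reassoc_of% hgl, reassoc_of% hgl', hcompT]
    · rw [reassoc_of% hgr, reassoc_of% hgr']
  have hcomap : I.comap g = I.comap g' := by
    refine idealSheaf_ext_of_openCover (coprodOpenCover.{0, 0} T Y) fun i => ?_
    rcases i with ⟨⟨⟩⟩ | ⟨⟨⟩⟩
    · change (I.comap g).comap coprod.inl = (I.comap g').comap coprod.inl
      rw [← Scheme.IdealSheafData.comap_comp, ← Scheme.IdealSheafData.comap_comp, hgl, hgl']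
      exact hcomapT
    · change (I.comap g).comap coprod.inr = (I.comap g').comap coprod.inr
      rw [← Scheme.IdealSheafData.comap_comp, ← Scheme.IdealSheafData.comap_comp, hgr, hgr']
  -- functoriality of the centre for `g` and `g'`, read off on the torus chart
  have hc := S.centre_comap f (g ≫ f) g rfl I hI hIi hsing n
  have hc' := S.centre_comap f (g' ≫ f) g' rfl I hI hIi hsing n
  rw [← hcomp, ← hcomap, hc] at hc'
  have hC : ((S.centre f I).piece n).comap act = ((S.centre f I).piece n).comap pr := by
    rw [← hgl, ← hgl', Scheme.IdealSheafData.comap_comp, Scheme.IdealSheafData.comap_comp, hc']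
  have hC' := congrArg (fun K : T.IdealSheafData => K.ideal ⟨⊤, isAffineOpen_top T⟩) hC
  simp only [act, pr] at hC'
  rw [comap_SpecMap_fromSpec_ideal_top, comap_SpecMap_fromSpec_ideal_top] at hC'
  simp only [φa, φp, CommRingCat.hom_ofHom] at hC'
  exact isHomogeneous_of_map_coaction_le 𝒜 ρ hρ (ideal_map_iso_inv_injective _ hC').le

end Summit.ResolutionOfSingularities.ResolutionOfSingularities.Theorems.DatumToEmbedded.CentreHomogeneous

/-! ## The tower over hypersurface pairs, driven by a strategy, with Bergh–Rydh over one field -/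

namespace Summit.ResolutionOfSingularities.ResolutionOfSingularities.Theorems.HypersurfaceStrategyTower

/-- **Every torus-quotient presentation of an integral hypersurface of `Y/k` has a resolved quotient,
granted a hypersurface centre strategy at `p = char k` and Bergh–Rydh over `k`**: well-founded induction
on the tower-step relation `HypersurfacePair.Step S.centre` (property `(T)` of the strategy). If the
hypersurface `X` is regular, the quotient has finite diagonalizable quotient singularities étale-locally
(`DatumToEmbedded.quotientSingularities_of_regular`) and the hypothesis resolves it. Otherwise the
strategy's centre is a regular weighted centre (`(iii)`) missing the generic point of `X` (`(ii')`) and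
homogeneous on the graded charts (`(i)`, `centre_isHomogeneous_of_strategy`); the datum-free tower
lemmas give the global cobordant blow-up `B₊ → Y` (smooth separated quasi-compact), the integral strict
transform, the quotient step (a blow-up `V' → V` downstairs and a graded atlas of rank `j + 1`), the
successor pair `(B₊, σˢ(ker i)|_{B₊})` is a hypersurface pair (`isLocallyPrincipal_strictTransformPlus`)
and is `Step`-below `(Y, ker i)` (`Step.intro`), so the induction hypothesis resolves `V'`, and `V`
along the blow-up. [cite: Wlodarczyk2022, Thm 1.1.4 (5), Thm 1.1.6; BerghRydh2019, Thm 5] -/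
theorem hasResolution_quotient_of_gradedAtlas
    {p : ℕ} (S : HypersurfaceCentreStrategy p) {k : Type} [Field k] [CharP k p] [PerfectField k]
    (hBR : ∀ (V : Scheme.{0}) (g : V ⟶ Spec (.of k)) [IsIntegral V] [IsSeparated g]
      [LocallyOfFiniteType g] [QuasiCompact g],
      (∀ v : V, ∃ (A : Type) (_ : AddCommGroup A) (_ : Finite A) (_ : DecidableEq A)
        (S : Type) (_ : CommRing S) (_ : Algebra k S) (𝒮 : A → Submodule k S)
        (_ : GradedAlgebra 𝒮), Algebra.FiniteType k S ∧ Algebra.Smooth k S ∧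
        ∃ φ : Spec (.of (𝒮 0)) ⟶ V, Etale φ ∧ v ∈ Set.range φ ∧
          φ ≫ g = Spec.map (CommRingCat.ofHom (algebraMap k (𝒮 0)))) →
      Scheme.HasResolution V)
    (P : HypersurfacePair k) :
    ∀ (X V : Scheme.{0}) (i : X ⟶ P.Y) [IsClosedImmersion i] [IsIntegral X], i.ker = P.X →
      ∀ (g : V ⟶ Spec (.of k)) [IsSeparated g] [LocallyOfFiniteType g] [QuasiCompact g]
        [IsIntegral V] (q : X ⟶ V), q ≫ g = i ≫ P.f → ∀ (j : ℕ), GradedAtlas j P.f i q →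
        Scheme.HasResolution V := by
  refine (S.wellFounded_step (k := k)).induction
    (C := fun P : HypersurfacePair k =>
      ∀ (X V : Scheme.{0}) (i : X ⟶ P.Y) [IsClosedImmersion i] [IsIntegral X], i.ker = P.X →
        ∀ (g : V ⟶ Spec (.of k)) [IsSeparated g] [LocallyOfFiniteType g] [QuasiCompact g]
          [IsIntegral V] (q : X ⟶ V), q ≫ g = i ≫ P.f → ∀ (j : ℕ), GradedAtlas j P.f i q →
          Scheme.HasResolution V) P ?_
  intro P ih
  obtain ⟨Y, f, I, hI, hIi⟩ := P
  dsimp only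
  intro X V i _ _ hIeq g _ _ _ _ q hq j 𝒜
  subst hIeq
  by_cases hreg : Scheme.IsRegular X
  · -- base: `X` regular ⇒ quotient singularities ⇒ Bergh–Rydh over `k`
    exact hBR V g (DatumToEmbedded.quotientSingularities_of_regular f i q g hq hreg 𝒜)
  · -- step
    have hsing : ¬ Scheme.IsRegular i.ker.subscheme := fun h =>
      hreg ((isRegular_iff_isRegular_image i).mpr h)
    haveI : IsLocallyNoetherian Y := LocallyOfFiniteType.isLocallyNoetherian f
    have hY : Scheme.IsRegular Y := Scheme.IsRegular.of_smooth f (Scheme.isRegular_Spec (.of k))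
    -- the strategy's centre is a regular weighted centre missing the generic point of `X`
    have hc : (S.centre f i.ker).IsRegularWeightedCentre :=
      S.isRegularWeightedCentre_centre f i.ker hI hIi hsing
    have hξ : i (genericPoint X) ∉ (S.centre f i.ker).support :=
      S.genericPoint_not_mem_support_centre f i hI hreg
    -- the Rees filtration of the centre
    let R' : ReesFiltration Y :=
      { ideal := (S.centre f i.ker).piece
        ideal_zero := (S.centre f i.ker).piece_zero
        antitone := antitone_piece hc
        mul_le := (S.centre f i.ker).piece_mul_le }
    -- the new ambient is smooth separated quasi-compact
    obtain ⟨hsm', hsep', hqc'⟩ :=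
      WeightedThesis.GlobalCobordantPlus.smooth_πPlus_comp_of_isRegularWeightedCentre f
        (S.centre f i.ker) hc R' rfl
    haveI := hsm'; haveI := hsep'; haveI := hqc'
    -- the strict transform is integral and lies over `X`
    obtain ⟨hint', hker⟩ :=
      DatumToEmbedded.StrictTransform.isIntegral_strictTransformPlus_of_not_mem_support i
        (S.centre f i.ker) hc R' rfl hξ
    haveI := hint'
    set I' := R'.strictTransformPlus i.ker with hI'
    -- the successor pair is a hypersurface pair
    have hI'lp : IsLocallyPrincipal I' :=
      WeightedThesis.HypersurfacePreserved.isLocallyPrincipal_strictTransformPlus hY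
        (S.centre f i.ker) hc R' rfl i.ker hI
    have hI'i : IsIntegral I'.subscheme := hint'
    let i' := I'.subschemeι
    let σX : I'.subscheme ⟶ X := IsClosedImmersion.lift i (i' ≫ R'.πPlus) hker
    have hσX : σX ≫ i = i' ≫ R'.πPlus := IsClosedImmersion.lift_fac _ _ _
    -- homogeneity of the centre on the charts, then the quotient step
    have hhom := fun (a : 𝒜.ι) (n : ℕ) =>
      @DatumToEmbedded.CentreHomogeneous.centre_isHomogeneous_of_strategy p S k _ _ _ Y f
        _ _ _ i.ker hI hIi hsing j (𝒜.W a) (𝒜.piece a) (𝒜.gradedRing a) (𝒜.appLE_mem a)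
        (𝒜.isHomogeneous_ker a) n
    obtain ⟨K, hK, hstep⟩ := DatumToEmbedded.quotientStep_of_isRegularWeightedCentre f i q g hq 𝒜
      (S.centre f i.ker) hc hξ hhom R' rfl σX hσX
    -- blow `V` up along `K`
    obtain ⟨V', ρ, hρ⟩ := exists_isBlowup V K
    haveI : IsLocallyNoetherian V := LocallyOfFiniteType.isLocallyNoetherian g
    haveI : IsProper ρ := hρ.isProper
    have hbir : IsBirational ρ := hρ.isBirational' hK
    haveI : IsIntegral V' := hρ.isIntegral hK
    obtain ⟨q', hq', ⟨𝒜'⟩⟩ := hstep V' ρ hρ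
    -- the successor pair is a step below `(Y, ker i)`: the induction hypothesis resolves `V'`
    have hlt : HypersurfacePair.Step (fun ⦃Y : Scheme.{0}⦄ (f : Y ⟶ Spec (.of k)) X => S.centre f X)
        (@HypersurfacePair.mk k _ R'.plus (R'.πPlus ≫ f) hsm' hsep' hqc' I' hI'lp hI'i)
        (@HypersurfacePair.mk k _ Y f inferInstance inferInstance inferInstance i.ker hI hIi) :=
      HypersurfacePair.Step.intro (@HypersurfacePair.mk k _ Y f inferInstance inferInstance inferInstance i.ker hI hIi) hsing R'
        rfl hsm' hsep' hqc' hI'lp hI'i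
    have hV' : Scheme.HasResolution V' := by
      have hQ' := ih _ hlt
      refine hQ' I'.subscheme V' i' (Scheme.IdealSheafData.ker_subschemeι I') (ρ ≫ g) q' ?_
        (j + 1) 𝒜'
      change q' ≫ ρ ≫ g = i' ≫ R'.πPlus ≫ f
      rw [← Category.assoc, hq', Category.assoc, hq, ← Category.assoc, hσX, Category.assoc]
    exact Scheme.HasResolution.of_isBirational ρ hbir hV'

end Summit.ResolutionOfSingularities.ResolutionOfSingularities.Theorems.HypersurfaceStrategyTower

end
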